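import Mathlib
import HarnessLib.Audit
import Summits.PneNP.PneNP.Theorems.ClusHilbertPhi
import Summits.PneNP.PneNP.Theorems.ClusHilbertInterpolation
import Summits.PneNP.PneNP.Theorems.ClusHilbertPeel

/-!
# Route ClusUniversalCertificate — colex-standard monomials: `#osh = |Y|`, `HF ≥ #osh_{≤d}`, `Φ ≤ S`, `Σ a_lex ≤ S` (osh-P2.md F1(a), F2)
(rung F-N1, cell pnp-ideate, crux `UniversalCertAll` = stmt-PneNP-19683; planner p1 g14, `HOME/pnp-ideate-p1/lines/osh-P2.md` §2 and the typed sketch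
`lines/osh-P2-UNREGISTERED.lean` — definitions `colexStd`, `oshS`, `oshCount`, `lexIncr` VERBATIM and the paper-proved statements F1(a) `oshCount_top`, F2
`oshCount_le_HF`, `Phi_le_oshS`, `sum_lexIncr_le_oshS` PROVED; restricted-model combinatorics — nothing here bears on `P` versus `NP`)

* `colexStd Y T` — `x_T` is a COLEX-STANDARD monomial for `Y` (its restriction to `Y` is not a combination of colex-smaller ones); `oshS`, `oshCount`, `lexIncr`;
* `map_evalOn_eq_map_resTo` — the degree-`≤ d` polynomial functions on `Y` are the restrictions of `Pdeg univ d`;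
* `linearIndependent_colexStd` — the standard restrictions are linearly independent (take the colex-largest non-zero coefficient);
* `mem_span_colexStd` — every monomial restriction is a combination of standard ones (well-founded induction along colex);
* `oshCount_le_HF` (**F2**), `oshCount_top` (**F1(a)**: exactly `|Y|` standard monomials), `Phi_le_oshS` (**`Φ(Y) ≤ S(Y)`**), `sum_lexIncr_le_oshS`
  (**`Σ_y a_lex(y) ≤ S(Y)`**, through `ClusHilbertPhi.hilbertBound'`).
-/

set_option linter.dupNamespace false -- `Summit.PneNP.PneNP.…`: summit = sub-problem name (D-0017 single-conjunct layout)

namespace Summit.PneNP.PneNP.Theorems.ClusHilbert.Osh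

open Finset
open Summit.PneNP.PneNP.Theorems.ClusCube (V)
open Summit.PneNP.PneNP.Theorems.ClusHilbert (HF Phi dimAt lexRank chi resTo evalOn Pdeg eval_mem_Pdeg exists_poly_of_mem_Pdeg finrank_Pdeg_univ
  HF_le_card hilbertBound')

variable {N : ℕ}

/-! ## Definitions (p1, osh-P2-UNREGISTERED.lean, verbatim) -/

/-- `x_T` is a COLEX-STANDARD monomial for `Y` (equivalently: `T` is order-shattered by `Y`): the monomial function `χ_T` restricted to `Y` is not a
linear combination of the restrictions of colex-smaller monomials (`x_{N-1}` is the largest variable). -/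
def colexStd (Y : Finset (V N)) (T : Finset (Fin N)) : Prop :=
  resTo Y (chi T) ∉ Submodule.span (ZMod 2) ((fun T' => resTo Y (chi T')) '' {T' : Finset (Fin N) | toColex T' < toColex T})

open Classical in
/-- `S(Y) = Σ_{T ∈ osh(Y)} |T|`: the degree sum of the colex-standard monomials. -/
noncomputable def oshS (Y : Finset (V N)) : ℕ :=
  ∑ T : Finset (Fin N), if colexStd Y T then T.card else 0

open Classical in
/-- number of colex-standard monomials of degree `≤ d` -/
noncomputable def oshCount (Y : Finset (V N)) (d : ℕ) : ℕ :=
  (univ.filter fun T : Finset (Fin N) => colexStd Y T ∧ T.card ≤ d).card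

/-- `a_lex(y)`: largest dimension of a linear `U` with `y + U ⊆ Y` all of whose nonzero vectors move `y` UP in lex (`lexRank`). -/
noncomputable def lexIncr (Y : Finset (V N)) (y : V N) : ℕ :=
  sSup {k : ℕ | ∃ U : Submodule (ZMod 2) (V N), Module.finrank (ZMod 2) U = k ∧
    (∀ u ∈ U, y + u ∈ Y) ∧ (∀ u ∈ U, u ≠ 0 → lexRank y < lexRank (y + u))}

/-! ## Polynomial functions of degree `≤ d` on `Y` -/

/-- **The degree-`≤ d` polynomial functions on `Y` are the restrictions of `Pdeg univ d`.** -/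
theorem map_evalOn_eq_map_resTo (Y : Finset (V N)) (d : ℕ) :
    Submodule.map (evalOn Y) (MvPolynomial.restrictTotalDegree (Fin N) (ZMod 2) d) = Submodule.map (resTo Y) (Pdeg (univ : Finset (Fin N)) d) := by
  refine le_antisymm ?_ ?_
  · rintro h ⟨p, hp, rfl⟩
    rw [SetLike.mem_coe, MvPolynomial.mem_restrictTotalDegree] at hp
    exact Submodule.mem_map.2 ⟨_, eval_mem_Pdeg p hp, rfl⟩
  · rintro h ⟨f, hf, rfl⟩
    obtain ⟨p, hp, hpf⟩ := exists_poly_of_mem_Pdeg hf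
    refine Submodule.mem_map.2 ⟨p, hp, ?_⟩
    funext y
    exact hpf y

/-- A monomial of degree `≤ d` restricts into the degree-`≤ d` space. -/
theorem resTo_chi_mem (Y : Finset (V N)) {T : Finset (Fin N)} {d : ℕ} (hT : T.card ≤ d) :
    resTo Y (chi T) ∈ Submodule.map (evalOn Y) (MvPolynomial.restrictTotalDegree (Fin N) (ZMod 2) d) := by
  rw [map_evalOn_eq_map_resTo]
  exact Submodule.mem_map.2 ⟨chi T, Submodule.subset_span ⟨T, subset_univ _, hT, rfl⟩, rfl⟩

/-! ## Independence and spanning of the standard monomials -/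

/-- **The colex-standard restrictions are linearly independent.** -/
theorem linearIndependent_colexStd (Y : Finset (V N)) :
    LinearIndependent (ZMod 2) (fun T : {T : Finset (Fin N) // colexStd Y T} => resTo Y (chi T.1)) := by
  classical
  rw [linearIndependent_iff']
  intro s c hsum T hT
  by_contra hcT
  -- the colex-largest index with non-zero coefficient
  obtain ⟨T₀, hT₀, hmax⟩ := exists_max_image (s.filter fun T => c T ≠ 0) (fun T => toColex T.1) ⟨T, mem_filter.2 ⟨hT, hcT⟩⟩
  rw [mem_filter] at hT₀
  have hc1 : c T₀ = 1 := by
    rcases (by decide : ∀ z : ZMod 2, z = 0 ∨ z = 1) (c T₀) with h | h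
    · exact absurd h hT₀.2
    · exact h
  -- isolate the top term
  have hsplit : resTo Y (chi T₀.1) = -∑ T ∈ s.erase T₀, c T • resTo Y (chi T.1) := by
    rw [← sum_erase_add _ _ hT₀.1, hc1, one_smul] at hsum
    exact eq_neg_of_add_eq_zero_right hsum
  apply T₀.2
  rw [hsplit]
  refine Submodule.neg_mem _ (Submodule.sum_mem _ fun T hT' => ?_)
  by_cases hc : c T = 0
  · rw [hc, zero_smul]; exact Submodule.zero_mem _
  · refine Submodule.smul_mem _ _ (Submodule.subset_span ⟨T.1, ?_, rfl⟩)
    have hle := hmax T (mem_filter.2 ⟨mem_of_mem_erase hT', hc⟩)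
    have hne : T.1 ≠ T₀.1 := fun h => ne_of_mem_erase hT' (Subtype.ext h)
    exact lt_of_le_of_ne hle fun h => hne (toColex.injective h)

/-- **Every monomial restriction is a combination of standard ones** (well-founded induction along colex). -/
theorem mem_span_colexStd (Y : Finset (V N)) (T : Finset (Fin N)) :
    resTo Y (chi T) ∈ Submodule.span (ZMod 2) (Set.range fun T : {T : Finset (Fin N) // colexStd Y T} => resTo Y (chi T.1)) := by
  haveI : Finite (Colex (Finset (Fin N))) := Finite.of_equiv _ toColex
  suffices key : ∀ c : Colex (Finset (Fin N)),
      resTo Y (chi (ofColex c)) ∈ Submodule.span (ZMod 2) (Set.range fun T : {T : Finset (Fin N) // colexStd Y T} => resTo Y (chi T.1)) by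
    simpa using key (toColex T)
  intro c
  induction c using WellFoundedLT.induction with
  | ind c ih =>
    by_cases hstd : colexStd Y (ofColex c)
    · exact Submodule.subset_span ⟨⟨_, hstd⟩, rfl⟩
    · unfold colexStd at hstd
      rw [not_not] at hstd
      refine (Submodule.span_le.2 ?_) hstd
      rintro _ ⟨T', hT', rfl⟩
      have h := ih (toColex T') (by simpa using hT')
      simpa using h

/-- The standard restrictions span all functions on `Y`. -/
theorem span_colexStd_eq_top (Y : Finset (V N)) :
    Submodule.span (ZMod 2) (Set.range fun T : {T : Finset (Fin N) // colexStd Y T} => resTo Y (chi T.1)) = ⊤ := by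
  classical
  refine eq_top_iff.2 fun h _ => ?_
  -- every function on `Y` is the restriction of a function of degree `≤ N`, i.e. of a combination of monomials
  have htop : Pdeg (univ : Finset (Fin N)) N = ⊤ := by
    apply Submodule.eq_top_of_finrank_eq
    rw [finrank_Pdeg_univ, Module.finrank_pi, Fintype.card_fun, ZMod.card, Fintype.card_fin]
    rw [Fintype.card_subtype, show (univ.filter fun S : Finset (Fin N) => S.card ≤ N) = univ from
      filter_true_of_mem fun S _ => (card_le_univ S).trans (by rw [Fintype.card_fin]), card_univ, Fintype.card_finset, Fintype.card_fin]
  let f : V N → ZMod 2 := fun v => if hv : v ∈ Y then h ⟨v, hv⟩ else 0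
  have hf : f ∈ Pdeg (univ : Finset (Fin N)) N := by rw [htop]; exact Submodule.mem_top
  have hres : resTo Y f = h := by
    funext v
    show (if hv : (v : V N) ∈ Y then h ⟨v, hv⟩ else 0) = h v
    rw [dif_pos v.2]
  rw [← hres]
  -- push the span membership of `f` through `resTo Y`
  unfold ClusHilbert.Pdeg at hf
  refine Submodule.span_induction (p := fun g _ => resTo Y g ∈ _) ?_ ?_ ?_ ?_ hf
  · rintro _ ⟨S, -, -, rfl⟩
    exact mem_span_colexStd Y S
  · rw [map_zero]; exact Submodule.zero_mem _
  · intro a b _ _ ha hb; rw [map_add]; exact Submodule.add_mem _ ha hb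
  · intro r a _ ha; rw [map_smul]; exact Submodule.smul_mem _ r ha

/-! ## F2 and F1(a) -/

/-- **F2 (level form): `HF_Y(d) ≥ #{T ∈ osh(Y) : |T| ≤ d}`.** -/
theorem oshCount_le_HF (Y : Finset (V N)) (d : ℕ) : oshCount Y d ≤ HF Y d := by
  classical
  set W := Submodule.map (evalOn Y) (MvPolynomial.restrictTotalDegree (Fin N) (ZMod 2) d) with hW
  -- the standard monomials of degree `≤ d`, as members of `W`
  let ι := {T : Finset (Fin N) // colexStd Y T ∧ T.card ≤ d}
  let b : ι → W := fun T => ⟨resTo Y (chi T.1), resTo_chi_mem Y T.2.2⟩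
  have hli : LinearIndependent (ZMod 2) b := by
    refine LinearIndependent.of_comp W.subtype ?_
    exact (linearIndependent_colexStd Y).comp (fun T : ι => ⟨T.1, T.2.1⟩) fun T T' h => Subtype.ext (congrArg (fun x => x.1) h)
  have hcard := hli.fintype_card_le_finrank
  have hι : Fintype.card ι = oshCount Y d := by
    unfold oshCount
    rw [Fintype.card_subtype]
  rw [hι] at hcard
  exact hcard

/-- **F1(a): there are exactly `|Y|` colex-standard monomials** (they restrict to a basis of the functions on `Y`). -/
theorem oshCount_top (Y : Finset (V N)) : oshCount Y N = Y.card := by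
  classical
  refine le_antisymm ((oshCount_le_HF Y N).trans (HF_le_card Y N)) ?_
  -- a spanning family has at least `dim` members
  have hspan := span_colexStd_eq_top Y
  have h1 : Module.finrank (ZMod 2) (Y → ZMod 2) ≤ Fintype.card {T : Finset (Fin N) // colexStd Y T} := by
    rw [← finrank_top, ← hspan]
    exact finrank_range_le_card _
  rw [Module.finrank_pi, Fintype.card_coe, Fintype.card_subtype] at h1
  refine h1.trans (card_le_card fun T hT => ?_)
  rw [mem_filter] at hT ⊢
  exact ⟨hT.1, hT.2, (card_le_univ T).trans (by rw [Fintype.card_fin])⟩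

/-! ## `Φ ≤ S` and `Σ a_lex ≤ S` -/

/-- `S(Y)` by layers: `S(Y) = Σ_{d<N} (#osh − #osh_{≤d})`. -/
theorem oshS_eq_sum (Y : Finset (V N)) : oshS Y = ∑ d ∈ range N, (oshCount Y N - oshCount Y d) := by
  classical
  have hstdN : ∀ T : Finset (Fin N), T.card ≤ N := fun T => (card_le_univ T).trans (by rw [Fintype.card_fin])
  have hsplit : ∀ d, oshCount Y N = oshCount Y d + (univ.filter fun T : Finset (Fin N) => colexStd Y T ∧ d < T.card).card := by
    intro d
    unfold oshCount
    rw [← card_union_of_disjoint]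
    · congr 1
      ext T
      simp only [mem_union, mem_filter, mem_univ, true_and]
      constructor
      · rintro ⟨h, -⟩
        by_cases hd : T.card ≤ d
        · exact Or.inl ⟨h, hd⟩
        · exact Or.inr ⟨h, not_le.1 hd⟩
      · rintro (⟨h, -⟩ | ⟨h, -⟩) <;> exact ⟨h, hstdN T⟩
    · exact disjoint_left.2 fun T h1 h2 => absurd (mem_filter.1 h1).2.2 (not_le.2 (mem_filter.1 h2).2.2)
  rw [sum_congr rfl fun d _ => by rw [hsplit d, Nat.add_sub_cancel_left]]
  unfold oshS
  have hT : ∀ T : Finset (Fin N), (if colexStd Y T then T.card else 0) =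
      ∑ d ∈ range N, (if colexStd Y T ∧ d < T.card then 1 else 0) := by
    intro T
    by_cases h : colexStd Y T
    · simp only [h, true_and, if_true]
      rw [sum_boole, Nat.cast_id]
      have : (range N).filter (fun d => d < T.card) = range T.card := by
        ext d; simp only [mem_filter, mem_range]; have := hstdN T; omega
      rw [this, card_range]
    · simp [h]
  rw [sum_congr rfl fun T _ => hT T, sum_comm]
  refine sum_congr rfl fun d _ => ?_
  rw [card_eq_sum_ones, sum_filter]

/-- **F2: `Φ(Y) ≤ S(Y)`.** -/
theorem Phi_le_oshS (Y : Finset (V N)) : Phi Y ≤ oshS Y := by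
  rw [oshS_eq_sum, oshCount_top]
  unfold ClusHilbert.Phi
  exact sum_le_sum fun d _ => Nat.sub_le_sub_left (oshCount_le_HF Y d) _

/-- The set defining `a_lex(y)` attains its supremum. -/
theorem exists_lexIncr (Y : Finset (V N)) {y : V N} (hy : y ∈ Y) :
    ∃ U : Submodule (ZMod 2) (V N), Module.finrank (ZMod 2) U = lexIncr Y y ∧ (∀ u ∈ U, y + u ∈ Y) ∧
      (∀ u ∈ U, u ≠ 0 → lexRank y < lexRank (y + u)) := by
  set S := {k : ℕ | ∃ U : Submodule (ZMod 2) (V N), Module.finrank (ZMod 2) U = k ∧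
    (∀ u ∈ U, y + u ∈ Y) ∧ (∀ u ∈ U, u ≠ 0 → lexRank y < lexRank (y + u))} with hS
  have hne : S.Nonempty := ⟨0, ⊥, finrank_bot _ _, fun u hu => by rw [(Submodule.mem_bot _).1 hu, add_zero]; exact hy,
    fun u hu hu0 => absurd ((Submodule.mem_bot _).1 hu) hu0⟩
  have hbdd : BddAbove S := ⟨N, fun k ⟨U, hU, _, _⟩ => by
    rw [← hU]; exact (Submodule.finrank_le U).trans (by rw [Module.finrank_pi, Fintype.card_fin])⟩
  obtain ⟨U, hU⟩ := Nat.sSup_mem hne hbdd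
  exact ⟨U, hU⟩

/-- **`Σ_y a_lex(y) ≤ Φ(Y)`** (`hilbertBound'` with the lex order). -/
theorem sum_lexIncr_le_Phi (Y : Finset (V N)) : ∑ y ∈ Y, lexIncr Y y ≤ Phi Y := by
  classical
  choose U hU using fun y : Y => exists_lexIncr Y y.2
  let U' : V N → Submodule (ZMod 2) (V N) := fun y => if hy : y ∈ Y then U ⟨y, hy⟩ else ⊥
  have hU' : ∀ y (hy : y ∈ Y), U' y = U ⟨y, hy⟩ := fun y hy => dif_pos hy
  have h := hilbertBound' Y lexRank U' (fun y hy u hu => by rw [hU' y hy] at hu; exact (hU ⟨y, hy⟩).2.1 u hu)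
    (fun y hy u hu hu0 => by rw [hU' y hy] at hu; exact (hU ⟨y, hy⟩).2.2 u hu hu0)
  refine le_trans (le_of_eq (sum_congr rfl fun y hy => ?_)) h
  rw [hU' y hy, (hU ⟨y, hy⟩).1]

/-- **F2 with Theorem 3: `Σ_y a_lex(y) ≤ Φ(Y) ≤ S(Y)`.** -/
theorem sum_lexIncr_le_oshS (Y : Finset (V N)) : ∑ y ∈ Y, lexIncr Y y ≤ oshS Y :=
  (sum_lexIncr_le_Phi Y).trans (Phi_le_oshS Y)

end Summit.PneNP.PneNP.Theorems.ClusHilbert.Osh
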